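import Summits.HodgeConjecture.HodgeConjecture.Theorems.Ring2AbelianAllAndreStandardANumerical
import Summits.HodgeConjecture.HodgeConjecture.Theorems.Ring2AbelianAllAndreNumericalCM
import Summits.HodgeConjecture.HodgeConjecture.Theorems.Ring2AbelianAllStandardAPencilsTransport
import Literature.AlgebraicGeometry.HodgeTheory.LefschetzStandardConjectureFacts
import Literature.AlgebraicGeometry.HodgeTheory.IsoTransport
import HarnessLib

/-!
# Ring 2 · sub-cell AbelianAll (ALL ABELIAN VARIETIES), André axis, part XVIII-e — THE LEFSCHETZ-`A` ROW WITHOUT THE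
# ABDULALI FACT (`HC_CM ∧ A_pen^CM ⟹ HC_AV`), AND THE ABDULALI FACTS `h₈A`, `h₈` FROM LIEBERMAN'S THEOREM: `Lieberman1968_lefschetzInvolution_algebraic_abelianVariety →
# Abdulali1994_invariantCycles_of_lefschetzStandardA` (and `→ …_of_lefschetzStandard`), by parts XVIII-a/d
# (Kleiman's `A ⇒ D` on the total space AND on the abelian fibres, the lift, flatness)

HONEST FRAMING (page 1, verbatim): **research route, not a corollary; conditional on HC_CM plus one named
minimal statement.** Cell line: research route conditional on HC_CM; not a corollary; Q11.4-sentence-2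
already refuted in dim ≥ 3. Nothing in this file proves a case of the Hodge conjecture for an abelian variety.
Seat `pub-hodge-ring2-ab-andre-2`, gen 10. NAMED-FACT LEDGER: the two Abdulali facts of the Lefschetz column
(`h₈` = `Abdulali1994_invariantCycles_of_lefschetzStandard`, seat ab-andre-1 part II; `h₈A` =
`Abdulali1994_invariantCycles_of_lefschetzStandardA`, part XIV-b) are DERIVED here from ONE classical refereed fact
already in the tree, Lieberman's theorem `B(A)` for abelian varieties (`Lieberman1968_lefschetzInvolution_algebraic_abelianVariety`,
Lieberman 1968 / Kleiman 1968 2A11) — which enters only to supply `A(𝒳_s, η)` on the FIBRES (abelian varieties); the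
total-space input `A(𝒳, η)` is the hypothesis of the facts themselves. No `_holds` for the Abdulali facts is claimed
(they remain implications `A(𝒳) ⇒ (1.1)_f` whose hypothesis is open); what is proved is that they are THEOREMS modulo
Lieberman, i.e. that print's Prop. 1 is kernel-derived from print's inputs.

## What is proved (theorems only; no definition, no named fact, no sorry)

§0 (pencil rows of Kleiman's `A ⇒ D`, part XVIII-d): `numerical_of_standardConjectureA` ((Num_t) from `A(𝒳)`),
`nondegenerate_fiberOver_of_standardConjectureA`, `comap_le_sup_of_standardConjectureA_of_HC_CM`,
**`cmFibreAlgebraicLift_of_HC_CM_of_cmPointedPencilStandardA`**, **`HC_AV_of_HC_CM_of_cmPointedPencilStandardA`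
(`h₂₁ → HC_CM → A_pen^CM → HC_AV`, NO Abdulali fact)**, `cmToAbelian_of_andre1996_of_cmPointedPencilStandardA'`,
**`invariantCyclesHoldFor_of_standardConjectureA_of_fibres`**, `cmPointedPencilNumerical_of_cmPointedPencilStandardA` (A_pen^CM ⟹ Num^CM).
§1 `nondegenerate_algebraicClasses_of_iso` (transport of (Perf) along an isomorphism of varieties).
§2 `forall_standardConjectureA_abelianVariety_of_lieberman` (`B(A) ⇒ A(A, η)`, seat ab-andre-1's part XIV §0),
**`nondegenerate_fiberOver_of_lieberman`** (`D` in every bidegree on every fibre of a compact abelian pencil).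
§3 **`invariantCyclesHoldFor_of_lieberman_of_standardConjectureA`** (one pencil: `A(𝒳) ⇒ (1.1)_f` granted Lieberman),
**`abdulali1994A_of_lieberman : Lieberman1968_… → Abdulali1994_invariantCycles_of_lefschetzStandardA`**,
**`abdulali1994_of_lieberman : Lieberman1968_… → Abdulali1994_invariantCycles_of_lefschetzStandard`**, and the node rows
`compactAbelianPencilVHC_of_lieberman_of_compactAbelianPencilStandardA`, `cmPointedCompactPencilVHC_of_lieberman_of_cmPointedPencilStandardA`.

References: Lieberman1968 (main theorem); Kleiman1968AlgebraicCycles (App. to §2 Thm. 2A11, §3 Cor. 3.9);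
Abdulali1994FamiliesAV (p. 1122, (1.1)); Milne2020HodgeClassesAV (Prop. 1, Rem. 5); Grothendieck1968 (§3 p. 196).
-/

noncomputable section

set_option linter.dupNamespace false

namespace Summit.HodgeConjecture.HodgeConjecture.Ring2.AbelianAll

open CategoryTheory AlgebraicGeometry
open Literature.AlgebraicGeometry Literature.AlgebraicGeometry.Motives
open Literature.AlgebraicGeometry.HodgeTheory
open Literature.AlgebraicTopology.SingularHomology (singularCohomology cupProduct cupProduct_map)
open Literature.AlgebraicGeometry.Abdulali1994 (InvariantCyclesHoldFor Abdulali1994_invariantCycles_of_lefschetzStandardA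
  Abdulali1994_invariantCycles_of_lefschetzStandard)
open Literature.AlgebraicGeometry.Deligne1982 (cmLocus)
open Literature.AlgebraicGeometry.Andre1996 (andre1996_cmAnchoredPencil)
open Summit.HodgeConjecture.HodgeConjecture.Theses
open Summit.HodgeConjecture.HodgeConjecture.Ring2.Deform (CompactAbelianPencilVHC CMPointedCompactPencilVHC)

/-! ## §0 Compact pencils: (Num) from `A(𝒳)`, (Perf) from `A(𝒳_t)`; the Lefschetz-`A` rows without `h₈A` -/

section Rows

variable {𝒳 S : SchemeOver ℂ}

/-- **(Num_t) from `A(𝒳, η)`**: if `A` holds for the `(d+1)`-dimensional TOTAL SPACE of a compact pencil (for every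
polarisation class), then for every `t` and `p + q = d`, an algebraic class `j_{t*} b` (`b ∈ N^q(𝒳_t)`) cup-orthogonal to
`N^p(𝒳)` vanishes (`D(𝒳)` in bidegree `(p, q+1)`, §3). [cite: Kleiman1968AlgebraicCycles, §3 Cor. 3.9]
[cite: Milne2020HodgeClassesAV, Prop. 1 (p. 7)] -/
theorem numerical_of_standardConjectureA {d : ℕ} {f : 𝒳 ⟶ S} (hf : IsCompactAbelianPencil f d) (t : ComplexPoints S)
    {p q : ℕ} (hpq : p + q = d)
    (hA : ∀ η : complexBetti 𝒳 2, IsPolarizationClass (d + 1) 𝒳 η → StandardConjectureA (d + 1) 𝒳 η) :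
    ∀ b ∈ algebraicClasses (fiberOver f t) q,
      (∀ a ∈ algebraicClasses 𝒳 p,
        cupProduct (show 2 * p + 2 * (q + 1) = 2 * (d + 1) by omega) a (fiberGysin hf t q b) = 0) →
        fiberGysin hf t q b = 0 :=
  fun b hb hab ↦ (nondegenerate_algebraicClasses_of_standardConjectureA hf.isSmoothProjective_total hA
    (show p + (q + 1) = d + 1 by omega)).2 (fiberGysin hf t q b) (fiberGysin_mem_algebraicClasses hf t hb) hab

/-- **(Perf_t) from `A(𝒳_t, η)`** for every polarisation class of the fibre (for an abelian fibre this is Lieberman's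
theorem `B(A) ⇒ A(A)` in print; kept as a hypothesis here). [cite: Lieberman1968, main theorem]
[cite: Kleiman1968AlgebraicCycles, §3 Cor. 3.9] -/
theorem nondegenerate_fiberOver_of_standardConjectureA {d : ℕ} {f : 𝒳 ⟶ S} (hf : IsCompactAbelianPencil f d)
    (t : ComplexPoints S) {p q : ℕ} (hpq : p + q = d)
    (hAt : ∀ η : complexBetti (fiberOver f t) 2, IsPolarizationClass d (fiberOver f t) η →
      StandardConjectureA d (fiberOver f t) η) :
    (∀ ξ ∈ algebraicClasses (fiberOver f t) p,
        (∀ b ∈ algebraicClasses (fiberOver f t) q, cupProduct (show 2 * p + 2 * q = 2 * d by omega) ξ b = 0) → ξ = 0) ∧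
      (∀ b ∈ algebraicClasses (fiberOver f t) q,
        (∀ ξ ∈ algebraicClasses (fiberOver f t) p, cupProduct (show 2 * p + 2 * q = 2 * d by omega) ξ b = 0) → b = 0) :=
  nondegenerate_algebraicClasses_of_standardConjectureA (hf.isSmoothProjective_fiberOver t) hAt hpq

/-- **`HC_CM ⊢ A(𝒳) ⟹ (L)_t` at a CM point** (`p + q = d`): (Num_t) from `A(𝒳)`, (Perf_t) from `HC_CM` (part XVIII-b),
the lift by part XVIII-a. `HC_CM` is a BINDER; NO Abdulali fact. [cite: Milne2020HodgeClassesAV, Prop. 1 (p. 7)]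
[cite: Andre1996Motifs, §6.3 (p. 33)] -/
theorem comap_le_sup_of_standardConjectureA_of_HC_CM (hCM : RankFourFaces.CMAbelianHodge) {d : ℕ} {f : 𝒳 ⟶ S}
    (hf : IsCompactAbelianPencil f d) {t : ComplexPoints S} (ht : t ∈ cmLocus f d) {p q : ℕ} (hpq : p + q = d)
    (hA : ∀ η : complexBetti 𝒳 2, IsPolarizationClass (d + 1) 𝒳 η → StandardConjectureA (d + 1) 𝒳 η) :
    (algebraicClasses (fiberOver f t) p).comap (complexBetti.map (fiberι f t) (2 * p)).hom ≤
      algebraicClasses 𝒳 p ⊔ LinearMap.ker (complexBetti.map (fiberι f t) (2 * p)).hom := by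
  obtain ⟨h₁, h₂⟩ := nondegenerate_algebraicClasses_fiberOver_of_HC_CM hCM hf ht hpq
  exact comap_le_sup_of_nondegenerate_of_numerical hf t hpq h₁ h₂ (numerical_of_standardConjectureA hf t hpq hA)

/-- **`HC_CM ∧ A_pen^CM ⟹ (L)`**: seat ab-andre-1's node `CMPointedPencilStandardA` (Grothendieck's `A(𝒳, η)` for the
total spaces of CM-pointed compact abelian pencils) gives the lift node of the André axis, granted `HC_CM` (BINDER) — with
NO Abdulali named fact. [cite: Milne2020HodgeClassesAV, Prop. 1 (p. 7)] [cite: Andre1996Motifs, Lemme 6.3.1 (p. 31) and §6.3 (p. 33)] -/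
theorem cmFibreAlgebraicLift_of_HC_CM_of_cmPointedPencilStandardA (hCM : RankFourFaces.CMAbelianHodge)
    (hA : CMPointedPencilStandardA) : CMFibreAlgebraicLift := by
  rw [cmFibreAlgebraicLift_iff_comap_le_sup]
  intro d 𝒳 S f hf p t ht
  have hA𝒳 : ∀ η : complexBetti 𝒳 2, IsPolarizationClass (d + 1) 𝒳 η → StandardConjectureA (d + 1) 𝒳 η := by
    obtain ⟨A₀, ⟨e₀⟩, -, hcm⟩ := ht
    exact hA f hf ⟨t, A₀, ⟨e₀⟩, hcm⟩
  rcases le_or_gt p d with hp | hp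
  · exact comap_le_sup_of_standardConjectureA_of_HC_CM hCM hf ht (show p + (d - p) = d by omega) hA𝒳
  · haveI := subsingleton_complexBetti (hf.isSmoothProjective_fiberOver t) (show 2 * d < 2 * p by omega)
    intro W _
    refine Submodule.mem_sup_right ?_
    rw [LinearMap.mem_ker]
    exact Subsingleton.elim _ _

/-- **THE LEFSCHETZ-`A` ROW OF THE ANDRÉ AXIS WITHOUT THE ABDULALI FACT: `h₂₁ → HC_CM → A_pen^CM → HC_AV`.** Compare seat
ab-andre-1's `HC_AV_of_abdulaliA_of_andre1996_of_HC_CM_of_cmPointedPencilStandardA` (part XIV-b), which needs the named fact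
`Abdulali1994_invariantCycles_of_lefschetzStandardA` (`h₈A`, Abdulali p. 1122 / Milne Prop. 1): here the transport step is
PROVED on the carriers (Kleiman's `A ⇒ D` on the total space, Hodge theory on the CM fibre, the lift of part XVIII-a), so
the only non-kernel inputs are the BINDERS `HC_CM` and `h₂₁` (André's Lemme 6.3.1). research route, not a corollary;
conditional on HC_CM plus one named minimal statement. [cite: Andre1996Motifs, Lemme 6.3.1 (p. 31) and Remarque 2 (p. 33)]
[cite: Milne2020HodgeClassesAV, Prop. 1 (p. 7) and Thm. 4] [cite: Kleiman1968AlgebraicCycles, §3 Cor. 3.9] -/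
theorem HC_AV_of_HC_CM_of_cmPointedPencilStandardA (h₂₁ : andre1996_cmAnchoredPencil)
    (hCM : RankFourFaces.CMAbelianHodge) (hA : CMPointedPencilStandardA) : PadicSemiregularLift.HodgeAbelianVarieties :=
  HC_AV_of_HC_CM_and_cmFibreAlgebraicLift h₂₁ hCM (cmFibreAlgebraicLift_of_HC_CM_of_cmPointedPencilStandardA hCM hA)

/-- The item reading: granted `h₂₁` only, `A_pen^CM ⟹ CMToAbelian` (stmt-HodgeConjecture-16267); nothing closes the item.
[cite: Andre1996Motifs, Remarque 2 (p. 33)] -/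
theorem cmToAbelian_of_andre1996_of_cmPointedPencilStandardA' (h₂₁ : andre1996_cmAnchoredPencil)
    (hA : CMPointedPencilStandardA) : RankFourFaces.CMToAbelian :=
  fun hCM A _ ↦ HC_AV_of_HC_CM_of_cmPointedPencilStandardA h₂₁ hCM hA A

/-- **Abdulali's (1.1)_f FROM `A` ALONE, NO NAMED FACT**: for a compact pencil of abelian `d`-folds, `A(𝒳, η)` for the total
space and `A(𝒳_s, η_s)` for every fibre (all polarisation classes; for the abelian fibres this is Lieberman's theorem in
print) give `InvariantCyclesHoldFor f d` — the content of the named fact `Abdulali1994_invariantCycles_of_lefschetzStandardA`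
with its fibre input displayed instead of cited. [cite: Abdulali1994FamiliesAV, (1.1) and p. 1122]
[cite: Milne2020HodgeClassesAV, Prop. 1 (p. 7)] [cite: Lieberman1968, main theorem] -/
theorem invariantCyclesHoldFor_of_standardConjectureA_of_fibres {d : ℕ} {f : 𝒳 ⟶ S} (hf : IsCompactAbelianPencil f d)
    (hA : ∀ η : complexBetti 𝒳 2, IsPolarizationClass (d + 1) 𝒳 η → StandardConjectureA (d + 1) 𝒳 η)
    (hAfib : ∀ (s : ComplexPoints S) (η : complexBetti (fiberOver f s) 2), IsPolarizationClass d (fiberOver f s) η →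
      StandardConjectureA d (fiberOver f s) η) :
    InvariantCyclesHoldFor f d :=
  invariantCyclesHoldFor_of_nondegenerate_of_numerical hf fun t _ _ hpq ↦
    ⟨(nondegenerate_fiberOver_of_standardConjectureA hf t hpq (hAfib t)).1,
      (nondegenerate_fiberOver_of_standardConjectureA hf t hpq (hAfib t)).2,
      numerical_of_standardConjectureA hf t hpq hA⟩

/-- **A_pen^CM ⟹ Num^CM** (Kleiman's `A ⇒ D` on the total space, part XVIII-d; the census edge between seat ab-andre-1's node and
part XVIII-c's). Unconditional. [cite: Kleiman1968AlgebraicCycles, §3 Cor. 3.9] -/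
theorem cmPointedPencilNumerical_of_cmPointedPencilStandardA (hA : CMPointedPencilStandardA) : CMPointedPencilNumerical := by
  intro d 𝒳 S f hf t ht p q hpq
  obtain ⟨A₀, ⟨e₀⟩, -, hcm⟩ := ht
  exact numerical_of_standardConjectureA hf t hpq (hA f hf ⟨t, A₀, ⟨e₀⟩, hcm⟩)

end Rows

/-! ## §1 Transport of (Perf) along an isomorphism -/

section Iso

variable {n : ℕ} {Y Y' : SchemeOver ℂ}

/-- **(Perf) is invariant under isomorphism**: if the cup pairing `N^p(Y) × N^q(Y) → H^{2n}` is non-degenerate on both sides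
then so is `N^p(Y') × N^q(Y') → H^{2n}` for `e : Y ≅ Y'` (pull-backs along `e`, `e⁻¹` exchange the algebraic classes —
the tree's `mem_algebraicClasses_map_iff_of_iso` — and are multiplicative). [cite: GrothendieckTopology1969, §1]
[cite: HatcherAT2002, §3.2 Prop. 3.10] -/
theorem nondegenerate_algebraicClasses_of_iso (e : Y ≅ Y') {p q : ℕ} (hpq : p + q = n)
    (h : (∀ ξ ∈ algebraicClasses Y p,
        (∀ b ∈ algebraicClasses Y q, cupProduct (show 2 * p + 2 * q = 2 * n by omega) ξ b = 0) → ξ = 0) ∧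
      (∀ b ∈ algebraicClasses Y q,
        (∀ ξ ∈ algebraicClasses Y p, cupProduct (show 2 * p + 2 * q = 2 * n by omega) ξ b = 0) → b = 0)) :
    (∀ ξ ∈ algebraicClasses Y' p,
        (∀ b ∈ algebraicClasses Y' q, cupProduct (show 2 * p + 2 * q = 2 * n by omega) ξ b = 0) → ξ = 0) ∧
      (∀ b ∈ algebraicClasses Y' q,
        (∀ ξ ∈ algebraicClasses Y' p, cupProduct (show 2 * p + 2 * q = 2 * n by omega) ξ b = 0) → b = 0) := by
  obtain ⟨h₁, h₂⟩ := h
  have hcup : ∀ (ξ' : complexBetti Y' (2 * p)) (b' : complexBetti Y' (2 * q)),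
      complexBetti.map e.hom (2 * n) (cupProduct (show 2 * p + 2 * q = 2 * n by omega) ξ' b') =
        cupProduct (show 2 * p + 2 * q = 2 * n by omega) (complexBetti.map e.hom (2 * p) ξ')
          (complexBetti.map e.hom (2 * q) b') :=
    fun ξ' b' ↦ cupProduct_map (AlgPoints.mapContinuous (L := ℂ) e.hom) _ ξ' b'
  refine ⟨fun ξ' hξ' hb' ↦ ?_, fun b' hb' hξ' ↦ ?_⟩
  · have hξ : complexBetti.map e.hom (2 * p) ξ' ∈ algebraicClasses Y p := (mem_algebraicClasses_map_iff_of_iso e).2 hξ'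
    have h0 : complexBetti.map e.hom (2 * p) ξ' = 0 := by
      refine h₁ _ hξ fun b hb ↦ ?_
      have hb'' : complexBetti.map e.inv (2 * q) b ∈ algebraicClasses Y' q :=
        (mem_algebraicClasses_map_iff_of_iso e.symm).2 hb
      rw [← e.complexBetti_map_hom_map_inv (2 * q) b, ← hcup, hb' _ hb'', map_zero]
    rw [← e.complexBetti_map_inv_map_hom (2 * p) ξ', h0, map_zero]
  · have hb : complexBetti.map e.hom (2 * q) b' ∈ algebraicClasses Y q := (mem_algebraicClasses_map_iff_of_iso e).2 hb'
    have h0 : complexBetti.map e.hom (2 * q) b' = 0 := by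
      refine h₂ _ hb fun ξ hξ ↦ ?_
      have hξ'' : complexBetti.map e.inv (2 * p) ξ ∈ algebraicClasses Y' p :=
        (mem_algebraicClasses_map_iff_of_iso e.symm).2 hξ
      rw [← e.complexBetti_map_hom_map_inv (2 * p) ξ, ← hcup, hξ' _ hξ'', map_zero]
    rw [← e.complexBetti_map_inv_map_hom (2 * q) b', h0, map_zero]

end Iso

/-! ## §2 Lieberman's theorem gives `D` on the fibres of a compact abelian pencil -/

/-- **`B(A) ⇒ A(A, η)` for every abelian variety and every polarisation class** (Lieberman's fact in the tree's
`⋆_L`-form, then seat ab-andre-1's `standardConjectureA_of_standardConjectureBStar`). [cite: Lieberman1968, main theorem]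
[cite: Grothendieck1968, §3 p. 196 (B(X) ⇒ A(X))] -/
theorem forall_standardConjectureA_abelianVariety_of_lieberman (hL : Lieberman1968_lefschetzInvolution_algebraic_abelianVariety)
    (A : AbelianVariety ℂ) :
    ∀ η : complexBetti A.X 2, IsPolarizationClass A.dim A.X η → StandardConjectureA A.dim A.X η :=
  fun η hη ↦ standardConjectureA_of_standardConjectureBStar AbelianVariety.isSmoothProjective_holds hη (hL A η)

variable {𝒳 S : SchemeOver ℂ}

/-- **(Perf_t) at EVERY fibre of a compact pencil of abelian varieties, granted Lieberman's theorem**: the fibre is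
`≅ A.X` for an abelian variety `A` of dimension `d`, `A(A.X, η)` holds for the Kähler class of a Kähler–rational datum
(Lieberman + `B ⇒ A`), so `D(A.X)` in every bidegree (part XVIII-d, Kleiman), transported along the isomorphism.
[cite: Lieberman1968, main theorem] [cite: Kleiman1968AlgebraicCycles, §3 Cor. 3.9] -/
theorem nondegenerate_fiberOver_of_lieberman (hL : Lieberman1968_lefschetzInvolution_algebraic_abelianVariety)
    {d : ℕ} {f : 𝒳 ⟶ S} (hf : IsCompactAbelianPencil f d) (t : ComplexPoints S) {p q : ℕ} (hpq : p + q = d) :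
    (∀ ξ ∈ algebraicClasses (fiberOver f t) p,
        (∀ b ∈ algebraicClasses (fiberOver f t) q, cupProduct (show 2 * p + 2 * q = 2 * d by omega) ξ b = 0) → ξ = 0) ∧
      (∀ b ∈ algebraicClasses (fiberOver f t) q,
        (∀ ξ ∈ algebraicClasses (fiberOver f t) p, cupProduct (show 2 * p + 2 * q = 2 * d by omega) ξ b = 0) → b = 0) := by
  obtain ⟨A, ⟨e⟩⟩ := hf.exists_abelianVariety_fiber t
  have hdim : A.dim = d := Andre1996.compactPencil_dim_eq_of_iso hf e
  have hND := nondegenerate_algebraicClasses_of_standardConjectureA (AbelianVariety.isSmoothProjective_holds (A := A))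
    (forall_standardConjectureA_abelianVariety_of_lieberman hL A) (p := p) (q := q) (by omega)
  subst hdim
  exact nondegenerate_algebraicClasses_of_iso e hpq hND

/-! ## §3 One pencil, the facts, the nodes -/

/-- **`A(𝒳) ⇒ (1.1)_f` for one compact pencil, granted Lieberman's theorem** ((Num) from `A(𝒳)`, part XVIII-d; (Perf) on
every fibre from Lieberman, §2; the lift and the flatness, part XVIII-a). [cite: Abdulali1994FamiliesAV, p. 1122 and (1.1)]
[cite: Milne2020HodgeClassesAV, Prop. 1 (p. 7)] [cite: Lieberman1968, main theorem] -/
theorem invariantCyclesHoldFor_of_lieberman_of_standardConjectureA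
    (hL : Lieberman1968_lefschetzInvolution_algebraic_abelianVariety) {d : ℕ} {f : 𝒳 ⟶ S} (hf : IsCompactAbelianPencil f d)
    (hA : ∀ η : complexBetti 𝒳 2, IsPolarizationClass (d + 1) 𝒳 η → StandardConjectureA (d + 1) 𝒳 η) :
    InvariantCyclesHoldFor f d :=
  invariantCyclesHoldFor_of_nondegenerate_of_numerical hf fun t _ _ hpq ↦
    ⟨(nondegenerate_fiberOver_of_lieberman hL hf t hpq).1, (nondegenerate_fiberOver_of_lieberman hL hf t hpq).2,
      numerical_of_standardConjectureA hf t hpq hA⟩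

/-- **THE ABDULALI FACT WITH PRINT'S HYPOTHESIS IS A THEOREM MODULO LIEBERMAN:
`Lieberman1968_lefschetzInvolution_algebraic_abelianVariety → Abdulali1994_invariantCycles_of_lefschetzStandardA`.**
The named fact `h₈A` (Abdulali 1994 p. 1122 / Milne 2020 Prop. 1, hypothesis `A(𝒳, η)`) of seat ab-andre-1's part XIV-b
needs no citation of its own: its printed proof's inputs — Lieberman on the fibres, Poincaré duality, Gysin functoriality,
flatness of the local system — are in the tree, the `θ_n`-splitting of the Leray filtration being replaced by the
fibrewise "hom ≡ num" argument of parts XVIII-a/d. [cite: Abdulali1994FamiliesAV, p. 1122] [cite: Milne2020HodgeClassesAV, Prop. 1 (p. 7)]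
[cite: Lieberman1968, main theorem] [cite: Kleiman1968AlgebraicCycles, §3 Cor. 3.9] -/
theorem abdulali1994A_of_lieberman (hL : Lieberman1968_lefschetzInvolution_algebraic_abelianVariety) :
    Abdulali1994_invariantCycles_of_lefschetzStandardA :=
  fun _ _ _ _ hf hA ↦ invariantCyclesHoldFor_of_lieberman_of_standardConjectureA hL hf hA

/-- **… and so is the `⋆_L`-form fact `h₈` of seat ab-andre-1's part II** (`h₈A ⟹ h₈`, part XIV-b).
[cite: Abdulali1994FamiliesAV, p. 1122] [cite: Grothendieck1968, §3 p. 196 (B(X) ⇒ A(X))] -/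
theorem abdulali1994_of_lieberman (hL : Lieberman1968_lefschetzInvolution_algebraic_abelianVariety) :
    Abdulali1994_invariantCycles_of_lefschetzStandard :=
  abdulali_lefschetzStandard_of_standardConjectureA (abdulali1994A_of_lieberman hL)

/-- **A_pen∀ ⟹ CompactAbelianPencilVHC granted Lieberman only** (seat ab-andre-1's row with `h₈A` discharged to Lieberman).
[cite: Abdulali1994FamiliesAV, p. 1122] [cite: Lieberman1968, main theorem] -/
theorem compactAbelianPencilVHC_of_lieberman_of_compactAbelianPencilStandardA
    (hL : Lieberman1968_lefschetzInvolution_algebraic_abelianVariety) (hA : CompactAbelianPencilStandardA) :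
    CompactAbelianPencilVHC :=
  compactAbelianPencilVHC_of_abdulaliA_of_compactAbelianPencilStandardA (abdulali1994A_of_lieberman hL) hA

/-- **A_pen^CM ⟹ CPVHC_CM granted Lieberman only.** [cite: Abdulali1994FamiliesAV, p. 1122] [cite: Lieberman1968, main theorem] -/
theorem cmPointedCompactPencilVHC_of_lieberman_of_cmPointedPencilStandardA
    (hL : Lieberman1968_lefschetzInvolution_algebraic_abelianVariety) (hA : CMPointedPencilStandardA) :
    CMPointedCompactPencilVHC :=
  cmPointedCompactPencilVHC_of_abdulaliA_of_cmPointedPencilStandardA (abdulali1994A_of_lieberman hL) hA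

end Summit.HodgeConjecture.HodgeConjecture.Ring2.AbelianAll

end
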